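import Literature.AlgebraicGeometry.Motives.OsculatingLineFamilyRelation
import HarnessLib

/-!
# Surfaces swept out by the lines of `X` (the image of `P_*` on curve classes) and the vertical components

R. Mboro, *Remarks on the `CH₂` of cubic hypersurfaces* (arXiv:1701.04488), works with the
universal-line correspondence `P_* = q_* p^* : CH₁(F(X)) → CH₂(X)` (§1, p. 6; Thm. 1.2:
"`d Γ + P_*(γ) ∈ ℤ · H_X^{n-r}`"; Thm. 1.3; Cor. 2.9 via Thm. 2.8 on `CH₁(F(X))`). On the class of
an integral curve `D ⊆ F(X)` the value of `P_*` is (a multiple of) the class of the SURFACE SWEPT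
OUT by the lines of `X` parametrised by `D`. This file introduces that notion on the tree's carriers,
without the universal line, as a property of points of `X`:

* `ProjFamily.IsLineSweptPoint i y` — `y ∈ X` has dimension `2` and `closure {y}` is swept out by a
  one-parameter family of lines of `X`: there are an integral proper curve `B` over `k` (regular:
  `trdeg_k k(B) = 1`, stalks at closed points principal — the normalisation of any parameter curve)
  and a `k(B)`-line of `X` (a line point `x` of the generic fibre `X_K`, `K = k(B)`) whose family
  `closure {ι x} ⊆ X ×ₖ B` pushes forward onto `closure {y}` (`pr₁ (ι x) = y`). The subgroup of
  `CH₂(X)` generated by these classes (`lineSweptClasses`) is the tree's rendering of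
  `Im(P_* : CH₁(F(X)) → CH₂(X))`.
* `ProjFamily.exists_lineSwept_of_vertical_over_curve`, `ProjFamily.exists_lineSwept_of_vertical'`,
  `ProjFamily.restrictMapFst_vertical_lineSwept` — **the vertical components of the relations of
  `Motives/OsculatingLineFamilyRelation` / `Motives/PlanesGenerateChowTwoOfCubic` push forward to
  integral combinations of line-swept classes, in EVERY dimension `d ≥ 1`**: a vertical component
  lies over a curve point `b` of the surface base `T` (over a closed point it is impossible,
  `exists_forms_of_vertical_of_mem`), is the closure of the `κ(b)`-LINE of the fibre
  (`exists_fibre_linePoint_of_vertical_of_mem`, `Motives/FibreVerticalLinesDim`), and transfers to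
  the family over the normalisation `Γ^ν` of `closure {b}` (`Motives/VerticalSurfaceOverCurve`).
  In `Motives/VerticalSurfacePlanes` the same components were turned into PLANES, at the price of
  `d ≥ 14` (plane chains over `C₁` fields); here nothing is converted, so no bound appears — this is
  the input for the low-dimensional form `CH₂(X) = ℤ · h + ⟨line-swept surfaces⟩` of Mboro's
  Thm. 1.2 + Thm. 1.3 (`Motives/LineSweptChowTwo`).

Everything is proved; the only definition is the predicate `IsLineSweptPoint` (and the set
`lineSweptClasses` of the corresponding classes).

## References

* [Mboro2018] R. Mboro, Remarks on the CH₂ of cubic hypersurfaces, arXiv:1701.04488, §1 (p. 6,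
  `P_*`), proof of Thm. 1.2 (p. 7: "`R` is a cycle in the image of `P_*`").
* [TianZong2014] Z. Tian, H. R. Zong, One-cycles on rationally connected varieties, Compositio
  Math. 150 (2014), proof of Prop. 7.2 (the family technique).
* [Fulton1998] W. Fulton, Intersection Theory, 2nd ed. (1998), §1.4 (proper push-forward).
-/

noncomputable section

open CategoryTheory CategoryTheory.Limits AlgebraicGeometry MonoidalCategory MvPolynomial
  TopologicalSpace Order Topology
open Literature.AlgebraicGeometry.Motives.Segre Literature.AlgebraicGeometry.Motives.RatFn

universe u

namespace Literature.AlgebraicGeometry.Motives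

attribute [local instance] MvPolynomial.gradedAlgebra MvPolynomial.algebraMvPolynomial
  Literature.AlgebraicGeometry.Motives.ProjBaseChange.algebraBase
  UniversalHyperplaneSection.sectionsAlgebra ProjFamily.functionFieldAlgebra

namespace ProjFamily

open ProjBaseChangeRing ProjectiveSpaceCells ProjectiveSpace FanoScheme ProjSpace
  Literature.RingTheory.MvPolynomial

variable {k : Type u} [Field k]

/-! ### Line-swept points -/

section Def

variable {d : ℕ} {X : SchemeOver k} (i : X ⟶ projectiveSpace (d + 1) k)

/-- **`closure {y} ⊆ X` is a surface swept out by a one-parameter family of lines of `X`**: `y` has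
dimension `2`, and there are an integral proper curve `B` over `k` with `trdeg_k k(B) = 1` and
principal stalks at closed points (a regular proper parameter curve) and a point `x` of the generic
fibre `X_K` of `X ×ₖ B → B` (`K = k(B)`) lying over a LINE point of `ℙᵈ⁺¹_K` (a `K`-line of `X`)
such that the family of lines `closure {ι x} ⊆ X ×ₖ B` maps onto `closure {y}` under `pr₁`
(`pr₁ (ι x) = y`). These are the surfaces whose classes make up the image of Mboro's
`P_* : CH₁(F(X)) → CH₂(X)` on curve classes (arXiv:1701.04488, §1 p. 6). [cite: Mboro2018, §1 (p. 6) and proof of Thm. 1.2 (p. 7)] -/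
def IsLineSweptPoint (y : ↥X.left) : Prop :=
  height y = 2 ∧ ∃ (B : SchemeOver k) (_ : IsIntegral B.left) (_ : IsProper B.hom),
    height (genericPoint B.left) = 1 ∧ Algebra.trdeg k B.left.functionField = 1 ∧
    (∀ b : B.left, IsClosed ({b} : Set B.left) → IsPrincipalIdealRing (B.left.presheaf.stalk b)) ∧
    ∃ x : ↥(XK B X), IsLinearSubspacePoint 1 (d + 1)
        (𝟙 (projectiveSpace (d + 1) B.left.functionField)) ((iK (d + 1) B X i).base x) ∧
      (CartesianMonoidalCategory.fst X B).left.base ((ιX B X).base x) = y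

variable {i}

/-- A line-swept point has dimension `2`. [folklore] -/
theorem IsLineSweptPoint.height_eq {y : ↥X.left} (h : IsLineSweptPoint i y) : height y = 2 := h.1

/-- The prime cycle of a line-swept point is a `2`-cycle. [folklore] -/
theorem IsLineSweptPoint.primeCycle_mem {y : ↥X.left} (h : IsLineSweptPoint i y) :
    primeCycle y ∈ cyclesOfDim X.left 2 :=
  primeCycle_mem_cyclesOfDim h.1

variable (i)

/-- The classes in `CH₂(X)` of the line-swept surfaces of `X ⊆ ℙᵈ⁺¹` — the tree's rendering of the
image of `P_* : CH₁(F(X)) → CH₂(X)` on curve classes (Mboro, arXiv:1701.04488, §1).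
[cite: Mboro2018, §1 (p. 6)] -/
def lineSweptClasses : Set (ChowGroup X.left 2) :=
  {x | ∃ (y : ↥X.left) (hy : IsLineSweptPoint i y), x = ChowGroup.ofPoint y hy.height_eq}

/-- Unfolding of `lineSweptClasses` (`Iff.rfl`). [folklore] -/
theorem mem_lineSweptClasses_iff (x : ChowGroup X.left 2) :
    x ∈ lineSweptClasses i ↔ ∃ (y : ↥X.left) (hy : IsLineSweptPoint i y), x = ChowGroup.ofPoint y hy.height_eq :=
  Iff.rfl

/-- A cycle supported on line-swept points is a `2`-cycle. [folklore] -/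
theorem mem_cyclesOfDim_of_lineSwept {c : AlgebraicCycle X.left ℤ}
    (hc : ∀ y, c y ≠ 0 → IsLineSweptPoint i y) : c ∈ cyclesOfDim X.left 2 :=
  fun y hy => (hc y hy).height_eq

end Def

/-! ### Vertical components are line-swept -/

section Vertical

variable [IsAlgClosed k] {d : ℕ} (T : SchemeOver k) [IsIntegral T.left] [IsProper T.hom]
  (X : SchemeOver k) (i : X ⟶ projectiveSpace (d + 1) k) [IsClosedImmersion i.left]

omit [IsAlgClosed k] [IsIntegral T.left] in
/-- **A vertical surface over a curve point is (a multiple of) a line-swept surface** — the part of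
`Motives/VerticalSurfacePlanes` before the conversion into planes, valid in every dimension: for an
integral proper base `T`, a point `b ∈ T` of dimension `1`, and a point `z ∈ X ×ₖ T` whose image in
`ℙᵈ⁺¹ ×ₖ T` is the fibre slice `σ_b` of the generic point of a `κ(b)`-line, `pr₁₊ [z] = m [y]` with
`y` line-swept whenever `m ≠ 0` (lift `z` to the generic fibre of `X ×ₖ Γ^ν → Γ^ν`, `Γ^ν` the
normalisation of `closure {b}`, where it lies over a `k(Γ^ν)`-line). [cite: TianZong2014, Prop. 7.2 (proof)] [cite: Mboro2018, proof of Thm. 1.2 (p. 7)] -/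
theorem exists_lineSwept_of_vertical_over_curve
    {U : T.left.Opens} (hU : IsAffineOpen U) (b : U) (hb1 : height (b : T.left) = 1)
    [Algebra Γ(T.left, U) (IsLocalRing.ResidueField (T.left.presheaf.stalk (b : T.left)))]
    [IsScalarTower Γ(T.left, U) (T.left.presheaf.stalk (b : T.left))
      (IsLocalRing.ResidueField (T.left.presheaf.stalk (b : T.left)))]
    {Lb : Fin (d + 1 - 1) → MvPolynomial (Fin (d + 1 + 1))
      (IsLocalRing.ResidueField (T.left.presheaf.stalk (b : T.left)))}
    (hLb : LinearIndependent (IsLocalRing.ResidueField (T.left.presheaf.stalk (b : T.left))) Lb)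
    (hLbhom : ∀ l, (Lb l).IsHomogeneous 1)
    [QuasiCompact (CartesianMonoidalCategory.fst X T).left]
    {z : ↥(X ⊗ T).left}
    (hz : (i ▷ T).left.base z =
      (Proj.map (mapGraded Γ(T.left, U)
        (IsLocalRing.ResidueField (T.left.presheaf.stalk (b : T.left))) (Fin (d + 1 + 1)))
        (irrelevant_le_map Γ(T.left, U)
          (IsLocalRing.ResidueField (T.left.presheaf.stalk (b : T.left))) (Fin (d + 1 + 1))) ≫
        openPiece (d + 1) T hU).base (linearSubspacePoint Lb hLb hLbhom (Nat.sub_le (d + 1) 1))) :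
    ∃ (m : ℕ) (y : ↥X.left),
      AlgebraicCycle.map (CartesianMonoidalCategory.fst X T).left height height (primeCycle z) =
        m • primeCycle y ∧ (m ≠ 0 → IsLineSweptPoint i y) := by
  classical
  set C := curveB T (b : T.left) with hC
  haveI : IsProper C.hom := isProper_curveB T (b : T.left)
  haveI : IsProper (projectiveSpace (d + 1) k).hom := isProper_projectiveSpace (d + 1) k
  haveI : IsProper X.hom := by rw [← Over.w i]; infer_instance
  haveI : QuasiCompact (CartesianMonoidalCategory.fst X C).left :=
    inferInstanceAs (QuasiCompact (pullback.fst X.hom C.hom))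
  haveI : LocallyOfFiniteType (X ⊗ C).hom :=
    inferInstanceAs (LocallyOfFiniteType (pullback.fst X.hom C.hom ≫ X.hom))
  have hB1 : height (genericPoint C.left) = 1 := height_genericPoint_curveB hb1
  have hpid : ∀ c : C.left, IsClosed ({c} : Set C.left) → IsPrincipalIdealRing (C.left.presheaf.stalk c) :=
    fun c _ => isPrincipalIdealRing_stalk_curveB hb1 c
  have htr : Algebra.trdeg k C.left.functionField = 1 := trdeg_curveB hb1
  -- `z` lies over `b`
  have hzb : (CartesianMonoidalCategory.snd X T).left.base z = (b : T.left) := by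
    have h1 : (CartesianMonoidalCategory.snd X T).left.base z =
        (CartesianMonoidalCategory.snd (projectiveSpace (d + 1) k) T).left.base ((i ▷ T).left.base z) := by
      change _ = ((i ▷ T).left ≫ (CartesianMonoidalCategory.snd (projectiveSpace (d + 1) k) T).left).base z
      rw [whiskerRight_left_snd]
    rw [h1, hz]
    have hmem : (Proj.map (mapGraded Γ(T.left, U)
        (IsLocalRing.ResidueField (T.left.presheaf.stalk (b : T.left))) (Fin (d + 1 + 1)))
        (irrelevant_le_map Γ(T.left, U)
          (IsLocalRing.ResidueField (T.left.presheaf.stalk (b : T.left))) (Fin (d + 1 + 1))) ≫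
        openPiece (d + 1) T hU).base (linearSubspacePoint Lb hLb hLbhom (Nat.sub_le (d + 1) 1)) ∈
        (CartesianMonoidalCategory.snd (projectiveSpace (d + 1) k) T).left.base ⁻¹' {(b : T.left)} := by
      rw [← range_fibreSlice (d + 1) T hU b]
      exact ⟨_, rfl⟩
    exact hmem
  -- lift `z` to the generic fibre of `X ×ₖ Γ^ν → Γ^ν`
  obtain ⟨x, hx⟩ := exists_point_XK_curveB_of_snd_eq T (b : T.left) X hzb
  -- `κ(b) ≅ k(Γ^ν)` and the `k`-structures
  obtain ⟨e, hgen, hek0⟩ := exists_ringEquiv_residueField_curveB T (b : T.left)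
    (curveν_genericPoint T (b : T.left))
  letI algkκ : Algebra k (IsLocalRing.ResidueField (T.left.presheaf.stalk (b : T.left))) :=
    ((algebraMap Γ(T.left, U) (IsLocalRing.ResidueField (T.left.presheaf.stalk (b : T.left)))).comp
      (algebraMap k Γ(T.left, U))).toAlgebra
  haveI : IsScalarTower k Γ(T.left, U) (IsLocalRing.ResidueField (T.left.presheaf.stalk (b : T.left))) :=
    IsScalarTower.of_algebraMap_eq fun _ => rfl
  have hek : ∀ c : k, e (algebraMap k (IsLocalRing.ResidueField (T.left.presheaf.stalk (b : T.left))) c) =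
      algebraMap k C.left.functionField c := by
    intro c
    have h1 : algebraMap k (IsLocalRing.ResidueField (T.left.presheaf.stalk (b : T.left))) c =
        T.left.Γevaluation (b : T.left) (T.hom.appTop ((Scheme.ΓSpecIso (.of k)).inv c)) := by
      change algebraMap Γ(T.left, U) _ (algebraMap k Γ(T.left, U) c) = _
      rw [IsScalarTower.algebraMap_apply Γ(T.left, U) (T.left.presheaf.stalk (b : T.left))]
      change IsLocalRing.residue _ (T.left.presheaf.germ U (b : T.left) b.2
        (SchemeOver.scalarRingHom T U c)) = _
      rw [SchemeOver.scalarRingHom_apply, Scheme.Hom.appLE, CommRingCat.comp_apply,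
        TopCat.Presheaf.germ_res_apply]
      rfl
    rw [h1]
    exact hek0 c
  -- `x` lies over a `k(Γ^ν)`-line point
  have hxline := isLinearSubspacePoint_iK_of_fibre_linePoint (d + 1) T (b : T.left) hU b (by omega)
    X i e hgen hek hLb hLbhom hz hx
  -- the push-forward, along the family over `Γ^ν`
  have key : AlgebraicCycle.map (CartesianMonoidalCategory.fst X T).left height height (primeCycle z) =
      AlgebraicCycle.map (CartesianMonoidalCategory.fst X C).left height height
        (primeCycle ((ιX C X).base x)) := by
    rw [← hx, map_fst_primeCycle_eq_of_curveB T (b : T.left) X x]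
  rw [algebraicCycleMap_primeCycle_eq_nsmul (CartesianMonoidalCategory.fst X C).left ((ιX C X).base x)] at key
  refine ⟨_, _, key, fun hm => ?_⟩
  -- `dim (ι x) = 2`, hence `dim y = 2` when the coefficient is non-zero
  have h2 : height ((ιX C X).base x) = 2 := by
    let V : ClosedSubvariety (XK C X) := ClosedSubvariety.ofPoint _ x
    have hdV := dim_image_eq (isPullback_ιX C X) (range_qgen C) hB1 V
    have hV : V.dim = 1 := by
      change height V.genericPoint = 1
      rw [ClosedSubvariety.genericPoint_ofPoint, ← height_base_eq_of_isClosedImmersion' (iK (d + 1) C X i),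
        hxline.height_eq]
      rfl
    have hI : (V.image (ιX C X)).dim = height ((ιX C X).base x) := by
      change height (V.image (ιX C X)).genericPoint = _
      rw [ClosedSubvariety.genericPoint_image, ClosedSubvariety.genericPoint_ofPoint]
    rw [← hI, hdV, hV]
    rfl
  have hy2 : height ((CartesianMonoidalCategory.fst X C).left.base ((ιX C X).base x)) = 2 := by
    have hh : height ((ιX C X).base x) =
        height ((CartesianMonoidalCategory.fst X C).left.base ((ιX C X).base x)) := by
      by_contra hne
      exact hm (by rw [AlgebraicCycle.mapCoeff, if_neg hne])
    rw [← hh, h2]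
  exact ⟨hy2, C, inferInstance, inferInstance, hB1, htr, hpid, x, hxline, rfl⟩

/-- **Vertical components over the surface base are (multiples of) line-swept surfaces** — the
analogue of `exists_planes_of_vertical'` in every dimension: for an integral proper base `T` with
generic point of dimension `2`, a `k`-morphism `f : T → ℙ^𝐍` whose generic point is the Plücker point
`[x ∧ y]` of the `k(T)`-line `V₊(μ) = [x][y]`, and a point `z ∈ X ×ₖ T` of dimension `2`, not over the
generic point, whose image in `ℙᵈ⁺¹ ×ₖ T` lies in the closure of the generic point `ι(V₊(μ))` of the
line: `pr₁₊[z] = m [y]` with `y` line-swept whenever `m ≠ 0` (`pr₂ z` is a curve point — over a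
closed point there is no such component, `exists_forms_of_vertical_of_mem` — and `z` sweeps the
family of lines of `X` over that curve). [cite: TianZong2014, Prop. 7.2 (proof)] [cite: Mboro2018, proof of Thm. 1.2 (p. 7)] -/
theorem exists_lineSwept_of_vertical' (hT2 : height (genericPoint T.left) = 2)
    (f : T ⟶ projectiveSpace ((d + 1) * (d + 1) + 2 * (d + 1)) k)
    (x y : Fin (d + 1 + 1) → T.left.functionField)
    (P : Fin ((d + 1) * (d + 1) + 2 * (d + 1) + 1) → T.left.functionField)
    (hPw : ∀ a b, P (plIdx (d + 1) (a, b)) = wedge x y a b) (hP0 : P ≠ 0)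
    (hP : qgen T ≫ f.left = (pointOfVec k P hP0).left)
    {μ : Fin (d + 1 - 1) → MvPolynomial (Fin (d + 1 + 1)) T.left.functionField}
    (hμli : LinearIndependent T.left.functionField μ) (hμhom : ∀ l, (μ l).IsHomogeneous 1)
    (hμideal : ∀ G : MvPolynomial (Fin (d + 1 + 1)) T.left.functionField,
      (∀ s t : T.left.functionField, eval (s • x + t • y) G = 0) → G ∈ Ideal.span (Set.range μ))
    {z : ↥(X ⊗ T).left} (hz2 : height z = 2)
    (hzη : (CartesianMonoidalCategory.snd X T).left.base z ≠ genericPoint T.left)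
    (hwS : (i ▷ T).left.base z ∈
      closure {(genericFibreι (d + 1) T).base (linearSubspacePoint μ hμli hμhom (Nat.sub_le (d + 1) 1))}) :
    ∃ (m : ℕ) (y' : ↥X.left),
      AlgebraicCycle.map (CartesianMonoidalCategory.fst X T).left height height (primeCycle z) =
        m • primeCycle y' ∧ (m ≠ 0 → IsLineSweptPoint i y') := by
  classical
  -- an affine neighbourhood of `b = pr₂ z`, and `b` as a point of it
  obtain ⟨_, ⟨U, hU, rfl⟩, hbU, -⟩ := T.left.isBasis_affineOpens.exists_subset_of_mem_open
    (Set.mem_univ ((CartesianMonoidalCategory.snd X T).left.base z)) isOpen_univ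
  obtain ⟨x', hx'⟩ : ∃ x' : U, (x' : T.left) = (CartesianMonoidalCategory.snd X T).left.base z :=
    ⟨⟨_, hbU⟩, rfl⟩
  set j := (i ▷ T).left with hj
  set lam := linearSubspacePoint μ hμli hμhom (Nat.sub_le (d + 1) 1) with hlam
  -- `w = (i × T) z` has dimension `2` and lies over `b`
  have hw2 : height (j.base z) = 2 := by rw [height_base_eq_of_isClosedImmersion' j z, hz2]
  have hwb : (CartesianMonoidalCategory.snd (projectiveSpace (d + 1) k) T).left.base (j.base z) =
      (x' : T.left) := by
    change (((i ▷ T).left ≫ (CartesianMonoidalCategory.snd (projectiveSpace (d + 1) k) T).left).base z) = _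
    rw [whiskerRight_left_snd, hx']
  -- `dim b < 2`
  have hblt : height (x' : T.left) < 2 := by
    rw [← hT2]
    have hle : (x' : T.left) ≤ genericPoint T.left :=
      Scheme.le_iff_specializes.mpr (genericPoint_specializes _)
    have hlt : (x' : T.left) < genericPoint T.left := lt_of_le_not_ge hle fun hge =>
      (hx' ▸ hzη) ((Scheme.le_iff_specializes.mp hge).antisymm (genericPoint_specializes _)).eq
    exact height_strictMono hlt (lt_of_le_of_lt (height_mono hlt.le) (by rw [hT2]; exact ENat.coe_lt_top 2))
  -- integral line forms at `b`
  obtain ⟨wv, hliO, hvan⟩ := exists_integralLineForms_of_pluecker (N := d + 1) (by omega) T f x y P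
    hPw hP0 hP (x' : T.left)
  have hlamI : (ProjectiveSpectrum.asHomogeneousIdeal
      (𝒜 := homogeneousSubmodule (Fin (d + 1 + 1)) T.left.functionField) lam).toIdeal =
        Ideal.span (Set.range μ) := toIdeal_linearSubspacePoint μ hμli hμhom _
  have hwmem : ∀ l, lin (Literature.LinearAlgebra.toFrac (T.left.presheaf.stalk (x' : T.left))
      T.left.functionField (wv l)) ∈
      ProjectiveSpectrum.asHomogeneousIdeal
        (𝒜 := homogeneousSubmodule (Fin (d + 1 + 1)) T.left.functionField) lam := by
    intro l
    change _ ∈ (ProjectiveSpectrum.asHomogeneousIdeal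
      (𝒜 := homogeneousSubmodule (Fin (d + 1 + 1)) T.left.functionField) lam).toIdeal
    rw [hlamI]
    refine hμideal _ fun s t => ?_
    rw [eval_lin_eq_sum]
    exact hvan l _ (Submodule.mem_span_pair.mpr ⟨s, t, rfl⟩)
  -- case `b` closed: impossible
  rcases (show height (x' : T.left) = 0 ∨ height (x' : T.left) = 1 by
      have h2 : height (x' : T.left) ≤ 1 := Order.le_of_lt_add_one (by exact_mod_cast hblt)
      rcases eq_or_lt_of_le h2 with h | h
      · exact Or.inr h
      · exact Or.inl (Order.lt_one_iff.mp h)) with hb0 | hb1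
  · exfalso
    have hbcl : IsClosed ({(x' : T.left)} : Set T.left) := isClosed_singleton_of_height_eq_zero' hb0
    obtain ⟨L, hLli, hLhom, hmem, hheq⟩ := exists_forms_of_vertical_of_mem T (genericFibreι (d + 1) T)
      (genericFibreι_fst (d + 1) T) (genericFibreι_snd (d + 1) T) lam hwS hbcl hwb wv hwmem hliO
    -- `pr₁ w` lies on the line `V₊(L)`, of dimension `≤ 1`, but has dimension `2`
    have hle1 : height ((CartesianMonoidalCategory.fst (projectiveSpace (d + 1) k) T).left.base
        (j.base z)) ≤ 1 := by
      have hd1 : d + 1 - 1 ≤ d + 1 := Nat.sub_le _ _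
      by_cases hne : (CartesianMonoidalCategory.fst (projectiveSpace (d + 1) k) T).left.base (j.base z) =
          linearSubspacePoint L hLli hLhom hd1
      · rw [hne, height_linearSubspacePoint, show d + 1 - (d + 1 - 1) = 1 by omega]; rfl
      · have hlt := height_lt_of_mem_zeroLocus L hLli hLhom hd1 hmem hne
        rw [show d + 1 - (d + 1 - 1) = 1 by omega] at hlt
        exact le_of_lt hlt
    rw [hheq, hw2] at hle1
    exact absurd hle1 (by norm_num)
  · -- `b` is a curve point: the family of lines over the curve
    letI algκ : Algebra Γ(T.left, U) (IsLocalRing.ResidueField (T.left.presheaf.stalk (x' : T.left))) :=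
      ((IsLocalRing.residue (T.left.presheaf.stalk (x' : T.left))).comp
        (algebraMap Γ(T.left, U) (T.left.presheaf.stalk (x' : T.left)))).toAlgebra
    haveI : IsScalarTower Γ(T.left, U) (T.left.presheaf.stalk (x' : T.left))
        (IsLocalRing.ResidueField (T.left.presheaf.stalk (x' : T.left))) :=
      IsScalarTower.of_algebraMap_eq fun _ => rfl
    have hfin : height (x' : T.left) ≠ ⊤ := by rw [hb1]; exact ENat.coe_ne_top 1
    have hheight : height (j.base z) = height (x' : T.left) + 1 := by rw [hw2, hb1]; rfl
    obtain ⟨hLli, hσ⟩ := exists_fibre_linePoint_of_vertical_of_mem (d + 1) T hU x' (by omega)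
      (genericFibreι (d + 1) T) (genericFibreι_fst (d + 1) T) (genericFibreι_snd (d + 1) T) lam hwS
      hwb hfin hheight wv hwmem hliO
    exact exists_lineSwept_of_vertical_over_curve T X i hU x' hb1 hLli (fun _ => isHomogeneous_lin _) hσ.symm

variable {F : MvPolynomial (Fin (d + 1 + 1)) k}

/-- **The push-forward of the vertical part is supported on line-swept points** — the analogue of
`exists_planes_restrictMapFst_of_vertical` in every dimension: for a cycle `V` on `ℙᵈ⁺¹ ×ₖ T`
supported on points `w` of dimension `2` in the closure of the generic point `ι(l)` of the
`k(T)`-line `l = [x][y]` (Plücker point the generic point of `f : T → ℙ^𝐍`), not over `η_T`, and on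
`pr₁⁻¹(X)`, every point in the support of `(pr₁₊ V)|_X` is line-swept (`exists_lineSwept_of_vertical'`
for each point of the — finite — support). [cite: TianZong2014, Prop. 7.2 (proof)] [cite: Mboro2018, proof of Thm. 1.2 (p. 7)] -/
theorem restrictMapFst_vertical_lineSwept
    (hrange : Set.range i.left.base =
      ProjectiveSpectrum.zeroLocus (homogeneousSubmodule (Fin (d + 1 + 1)) k) {F})
    (hT2 : height (genericPoint T.left) = 2)
    (f : T ⟶ projectiveSpace ((d + 1) * (d + 1) + 2 * (d + 1)) k)
    (x y : Fin (d + 1 + 1) → T.left.functionField)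
    (P : Fin ((d + 1) * (d + 1) + 2 * (d + 1) + 1) → T.left.functionField)
    (hPw : ∀ a b, P (plIdx (d + 1) (a, b)) = wedge x y a b) (hP0 : P ≠ 0)
    (hP : qgen T ≫ f.left = (pointOfVec k P hP0).left)
    {μ : Fin (d + 1 - 1) → MvPolynomial (Fin (d + 1 + 1)) T.left.functionField}
    (hμli : LinearIndependent T.left.functionField μ) (hμhom : ∀ l, (μ l).IsHomogeneous 1)
    (hμideal : ∀ G : MvPolynomial (Fin (d + 1 + 1)) T.left.functionField,
      (∀ s t : T.left.functionField, eval (s • x + t • y) G = 0) → G ∈ Ideal.span (Set.range μ))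
    (V : AlgebraicCycle ((projectiveSpace (d + 1) k) ⊗ T).left ℤ)
    (hV : ∀ w', V w' ≠ 0 →
      genericFibreι (d + 1) T (linearSubspacePoint μ hμli hμhom (Nat.sub_le (d + 1) 1)) ⤳ w' ∧
      height w' = (2 : ℕ) ∧
      (CartesianMonoidalCategory.snd (projectiveSpace (d + 1) k) T).left w' ≠ genericPoint T.left ∧
      F ∈ ProjectiveSpectrum.asHomogeneousIdeal (𝒜 := homogeneousSubmodule (Fin (d + 1 + 1)) k)
        ((CartesianMonoidalCategory.fst (projectiveSpace (d + 1) k) T).left w')) :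
    ∀ y', restrictMapFst T X i V y' ≠ 0 → IsLineSweptPoint i y' := by
  classical
  haveI : IsProper (projectiveSpace (d + 1) k).hom := isProper_projectiveSpace (d + 1) k
  haveI : QuasiCompact ((projectiveSpace (d + 1) k) ⊗ T).hom :=
    inferInstanceAs (QuasiCompact (pullback.fst (projectiveSpace (d + 1) k).hom T.hom ≫
      (projectiveSpace (d + 1) k).hom))
  haveI : CompactSpace ↥((projectiveSpace (d + 1) k) ⊗ T).left :=
    compactSpace_of_quasiCompact_hom ((projectiveSpace (d + 1) k) ⊗ T)
  let R := restrictMapFst T X i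
  -- each point of the support of `V` pushes forward to a multiple of a line-swept point
  have hVls : ∀ w', V w' ≠ 0 → ∃ (m : ℕ) (y'' : ↥X.left),
      R (primeCycle w') = m • primeCycle y'' ∧ (m ≠ 0 → IsLineSweptPoint i y'') := by
    intro w' hw'
    obtain ⟨hsp, hh2, hη, hFmem⟩ := hV w' hw'
    -- `w'` lies on `X ×ₖ T`
    have hw'X : w' ∈ Set.range (i ▷ T).left.base := by
      rw [range_whiskerRight_left_eq T i, Set.mem_preimage, hrange]
      intro G hG
      rw [Set.mem_singleton_iff.mp hG]
      exact hFmem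
    obtain ⟨z, rfl⟩ := hw'X
    have hz2 : height z = 2 := by
      rw [← height_base_eq_of_isClosedImmersion' (i ▷ T).left z, hh2]; rfl
    have hzη : (CartesianMonoidalCategory.snd X T).left.base z ≠ genericPoint T.left := by
      intro h
      apply hη
      change (((i ▷ T).left ≫ (CartesianMonoidalCategory.snd (projectiveSpace (d + 1) k) T).left).base z) = _
      rw [whiskerRight_left_snd]
      exact h
    have hwS : (i ▷ T).left.base z ∈
        closure {(genericFibreι (d + 1) T).base (linearSubspacePoint μ hμli hμhom (Nat.sub_le (d + 1) 1))} :=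
      specializes_iff_mem_closure.mp hsp
    obtain ⟨m, y'', hmy, hls⟩ := exists_lineSwept_of_vertical' T X i hT2 f x y P hPw hP0 hP hμli hμhom
      hμideal hz2 hzη hwS
    refine ⟨m, y'', ?_, hls⟩
    change restrictMapFst T X i (primeCycle ((i ▷ T).left.base z)) = _
    rw [restrictMapFst_primeCycle_whiskerRight]
    exact hmy
  intro y' hy'
  haveI : Nonempty ↥X.left := ⟨y'⟩
  choose! mf yf hmf hlsf using hVls
  let S : Finset ↥((projectiveSpace (d + 1) k) ⊗ T).left := (finite_support_of_compactSpace V).toFinset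
  have hSmem : ∀ w', w' ∈ S ↔ V w' ≠ 0 := fun w' => by
    simp only [S, Set.Finite.mem_toFinset, Function.mem_support]
  have hVsum : V = ∑ w' ∈ S, V w' • primeCycle w' :=
    eq_sum_smul_primeCycle_of_support_subset V (s := S) (by
      intro w' hw'; exact Finset.mem_coe.2 ((hSmem w').2 (Function.mem_support.1 hw')))
  have hRV : R V = ∑ w' ∈ S, V w' • ((mf w' : ℤ) • primeCycle (yf w')) := by
    conv_lhs => rw [hVsum]
    rw [map_sum]
    refine Finset.sum_congr rfl fun w' hw' => ?_
    rw [map_zsmul, hmf w' ((hSmem w').1 hw'), natCast_zsmul]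
  have : ∃ w' ∈ S, (V w' • ((mf w' : ℤ) • primeCycle (yf w'))) y' ≠ 0 := by
    by_contra hnone
    push Not at hnone
    apply hy'
    change R V y' = 0
    rw [hRV, Function.locallyFinsuppWithin.coe_sum, Finset.sum_apply]
    exact Finset.sum_eq_zero fun w' hw' => hnone w' hw'
  obtain ⟨w', hw'S, hw'y⟩ := this
  have hVw' : V w' ≠ 0 := (hSmem w').1 hw'S
  have hm : mf w' ≠ 0 := by
    intro h0
    apply hw'y
    rw [h0, Nat.cast_zero, zero_smul, smul_zero]
    rfl
  have hyy : y' = yf w' := by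
    by_contra hne
    apply hw'y
    rw [Function.locallyFinsuppWithin.coe_zsmul, Pi.smul_apply, Function.locallyFinsuppWithin.coe_zsmul,
      Pi.smul_apply, primeCycle_apply_of_ne hne, smul_zero, smul_zero]
  rw [hyy]
  exact hlsf w' hVw' hm

end Vertical

end ProjFamily

end Literature.AlgebraicGeometry.Motives
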